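/-
Copyright (c) 2026. All rights reserved.
Released under Apache 2.0 license as described in the file LICENSE.
Authors: abc-iut cell, prover seat abc-iut-f-101 (F fact-proving wave), over the statements of abc-iut-L4-t3.
-/
import Mathlib.Algebra.Category.Grp.Preadditive
import Mathlib.CategoryTheory.Preadditive.FunctorCategory
import Literature.AnabelianGeometry.AbsoluteAnabelian.LogFrobeniusCorollaries
import HarnessLib

/-!
# [AbsTopIII] Corollary 5.5 (iii), `⊞`-half (`Cor55Observables`, FACT-LIST F-0142): the observable `S_log⊞` FORCES the commutativity of the `ι⊞`-squares of `Γ⃗^log_v` — necessity, and the universal closure REFUTED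

S. Mochizuki, *Topics in absolute anabelian geometry III: global reconstruction algorithms*,
J. Math. Sci. Univ. Tokyo 22 (2015) 939–1156 [MochizukiAbsTopIII2015]; locators `p.N` = pages of the author's
manuscript (`paper:url-5493eb38cbb7`), read on the page: Def 5.4 (iii) p. 126 (the commutative diagram
`𝒪^×_k̄ ↪ k̄^× ↪ k̄` over `k~ → k~ ↪ (k̄^×)^pf` defining `Γ⃗^log_non`), (v) p. 127 (`Γ⃗^log_arc`), (vii) p. 128
(`ι⊞_{v,ε}` induced by the arrow `ε`), Cor 5.5 (iii) p. 131 ("the natural transformations `ι⊞_{v,ε}` belong to a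
family of homotopies on `D•_{≤3}` that determines on the portion of `D•_{≤3}` indexed by `v` a structure of observable
`S_log⊞` on `D•_{≤2}`"), §0 p. 26 / Def 3.5 (ii) p. 75 (saturated boundary sets; one homotopy per pair, composition).

PROOF-ONLY companion (theorems only; nothing restated) of abc-iut-L4-t3's `LogFrobeniusCorollaries.lean`, whose
`LogFrobeniusSetting.Cor55Observables L` — for each `v`, some family of homotopies on `D•_{≤2} ∪ {𝒩⊞_v}` is an
observable whose boundary pairs `([λ⊞_{v,ν₁}], [λ⊞_{v,ν₂}])` carry exactly the `ι⊞_{v,ε}` (`IsLogObservablePlus`) — is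
the cell's frozen FACT-LIST row F-0142, PARAMETRISED by the interface `L` (the trunk file's docstring: "ASSUMPTIONS on
`L` that the text asserts for the genuine theaters").  Two kernel facts locate its exact content beyond the interface:

* NECESSITY (`iota_comp_eq_of_isLogObservablePlus`, `iota_comp_eq_of_cor55Observables`): an observable `S_log⊞` at
  `v` forces, for any two 2-chains `ν₁ → ν₂ → ν₃`, `ν₁ → ν₂' → ν₃` of `ι⊞`-carrying edges between pre-log vertices, the
  EQUALITY of the composites of the `ι⊞`-components — the boundary set of a family of homotopies is transitive and
  carries one homotopy per pair, multiplicative along compositions (Def 3.5 (ii)).  At a nonarchimedean `v` the graph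
  `Γ⃗^⋉_non` has such a square, `𝒪^×_k̄ ↪ k̄^× → (k̄^×)^pf` / `𝒪^×_k̄ →(shell) k~ ↪ (k̄^×)^pf`
  (`exists_iotaSquare_of_eq_false`); at an archimedean `v` it has none (`logEdge_chain_unique_of_eq_true`).  Print HAS
  this commutativity (Def 5.4 (iii) calls the diagram commutative, and `ι⊞_{v,ε}` is induced by `ε`); the interface
  field `LogFrobeniusSetting.iota` does not record it.
* UNIVERSAL CLOSURE REFUTED (`exists_not_cor55Observables_of_preadditive`, `exists_not_cor55Observables`,
  `not_forall_cor55Observables`): over every index set with a nonarchimedean place there is a setting violating the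
  square — the diagonal setting on `AddCommGrpCat` with `ι⊞ := 0` on the single edge `𝒪^×_k̄ ↪ k̄^×` and the identity
  identification elsewhere (`0 ≫ 𝟙 ≠ 𝟙 ≫ 𝟙` at `ℤ`).  DEGENERATE consistency witness, as in
  `LogFrobeniusSettingNonVacuity.lean` / `LogFrobeniusLogWallNonVacuity.lean`; no arithmetic content.

So F-0142 is NOT a formal consequence of the interface; it is admissible only as an assumption on `L` (R5), and its
interface-level content at the places where it can fail is exactly the Def 5.4 (iii) commutativity of the `ι⊞`'s
(the converse — an observable `S_log⊞` from commuting squares — is the subject of a separate companion file).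
Refereed pre-IUT material; nothing here bears on [IUTchIII] Cor. 3.12; OUR kernel check, no side taken.
-/

set_option autoImplicit false

universe u

open CategoryTheory Quiver

namespace Literature.AnabelianGeometry.AbsoluteAnabelian

namespace LogFrobeniusSetting

variable {Vmod : Type u} {isArc : Vmod → Bool} (L : LogFrobeniusSetting Vmod isArc)

/-! ## Necessity: two `ι⊞`-chains with the same end-vertices have the same composite -/

/-- **The observable `S_log⊞` forces commuting `ι⊞`-squares.**  If the `ι⊞_{v,ε}` belong to a family of homotopies
making `D•_{≤2} ∪ {𝒩⊞_v}` an observable as typed (`IsLogObservablePlus`: the pair `([λ⊞_{v,ν₁}], [λ⊞_{v,ν₂}])` is a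
boundary pair with homotopy `ι⊞_{v,ε}` for every `ι⊞`-carrying edge `ε : ν₁ → ν₂` between pre-log vertices), then for
any two such 2-chains `ν₁ → ν₂ → ν₃`, `ν₁ → ν₂' → ν₃` of `Γ⃗^log_v` with common end-vertices the composites of the
`ι⊞`-components agree at every object — because the boundary set of a family of homotopies is saturated (Def 3.5
(ii) (a), §0: transitive) and carries ONE homotopy per pair, multiplicative under composition of pairs.  (Components
are compared through `HEq` since the functor `Λ_ν = frobeniusTwist` in the domain of `ι⊞_{v,ε}` is only
propositionally the identity at a pre-log vertex.) [cite: MochizukiAbsTopIII2015, Cor 5.5 (iii) p. 131] -/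
theorem iota_comp_eq_of_isLogObservablePlus (v : Vmod) (H : (L.logDiagramPlus v).HomotopyFamily)
    (hH : L.IsLogObservablePlus v H) {ν₁ ν₂ ν₂' ν₃ : LogVertex (isArc v)}
    (h₁ : ν₁.isPostLog = false) (h₂ : ν₂.isPostLog = false) (h₂' : ν₂'.isPostLog = false)
    (h₃ : ν₃.isPostLog = false) (ε₁₂ : LogEdge (isArc v) ν₁ ν₂) (ε₂₃ : LogEdge (isArc v) ν₂ ν₃)
    (ε₁₂' : LogEdge (isArc v) ν₁ ν₂') (ε₂'₃ : LogEdge (isArc v) ν₂' ν₃) (X₀ : L.X)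
    (m₁₂ : (L.lam v ν₁).obj X₀ ⟶ (L.lam v ν₂).obj X₀) (m₂₃ : (L.lam v ν₂).obj X₀ ⟶ (L.lam v ν₃).obj X₀)
    (m₁₂' : (L.lam v ν₁).obj X₀ ⟶ (L.lam v ν₂').obj X₀) (m₂'₃ : (L.lam v ν₂').obj X₀ ⟶ (L.lam v ν₃).obj X₀)
    (hm₁₂ : HEq m₁₂ ((L.iota v ε₁₂).app X₀)) (hm₂₃ : HEq m₂₃ ((L.iota v ε₂₃).app X₀))
    (hm₁₂' : HEq m₁₂' ((L.iota v ε₁₂').app X₀)) (hm₂'₃ : HEq m₂'₃ ((L.iota v ε₂'₃).app X₀)) :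
    m₁₂ ≫ m₂₃ = m₁₂' ≫ m₂'₃ := by
  obtain ⟨-, hpre, -⟩ := hH
  obtain ⟨e₁₂, c₁₂⟩ := hpre ν₁ ν₂ ε₁₂ h₁ h₂
  obtain ⟨e₂₃, c₂₃⟩ := hpre ν₂ ν₃ ε₂₃ h₂ h₃
  obtain ⟨e₁₂', c₁₂'⟩ := hpre ν₁ ν₂' ε₁₂' h₁ h₂'
  obtain ⟨e₂'₃, c₂'₃⟩ := hpre ν₂' ν₃ ε₂'₃ h₂' h₃
  obtain ⟨a₁₂, b₁₂, c₁₂⟩ := c₁₂ X₀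
  obtain ⟨a₂₃, b₂₃, c₂₃⟩ := c₂₃ X₀
  obtain ⟨a₁₂', b₁₂', c₁₂'⟩ := c₁₂' X₀
  obtain ⟨a₂'₃, b₂'₃, c₂'₃⟩ := c₂'₃ X₀
  -- one homotopy for the pair `([λ⊞_{ν₁}], [λ⊞_{ν₃}])`, computed along either chain
  have key : H.η e₁₂ ≫ H.η e₂₃ = H.η e₁₂' ≫ H.η e₂'₃ := by
    rw [← H.η_trans e₁₂ e₂₃, ← H.η_trans e₁₂' e₂'₃]
  have keyX := congrArg (fun α => α.app X₀) key
  simp only [NatTrans.comp_app, c₁₂, c₂₃, c₁₂', c₂'₃, Category.assoc] at keyX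
  have k₂ := (cancel_epi (eqToHom a₁₂)).mp keyX
  simp only [← Category.assoc] at k₂
  have k₃ := (cancel_mono (eqToHom b₂₃)).mp k₂
  simp only [Category.assoc, eqToHom_trans] at k₃
  -- the plain components `m` are the `ι⊞`-components conjugated by the casts
  have t₁ : (L.lam v ν₁).obj X₀ = (frobeniusTwist L.log ν₁.isPostLog ⋙ L.lam v ν₁).obj X₀ := by
    simp [frobeniusTwist, h₁]
  have t₂ : (L.lam v ν₂).obj X₀ = (frobeniusTwist L.log ν₂.isPostLog ⋙ L.lam v ν₂).obj X₀ := by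
    simp [frobeniusTwist, h₂]
  have t₂' : (L.lam v ν₂').obj X₀ = (frobeniusTwist L.log ν₂'.isPostLog ⋙ L.lam v ν₂').obj X₀ := by
    simp [frobeniusTwist, h₂']
  rw [(conj_eqToHom_iff_heq m₁₂ _ t₁ rfl).mpr hm₁₂, (conj_eqToHom_iff_heq m₂₃ _ t₂ rfl).mpr hm₂₃,
    (conj_eqToHom_iff_heq m₁₂' _ t₁ rfl).mpr hm₁₂', (conj_eqToHom_iff_heq m₂'₃ _ t₂' rfl).mpr hm₂'₃]
  simp only [eqToHom_refl, Category.comp_id, Category.assoc]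
  congr 1

/-- **Cor 5.5 (iii) `⊞`-half as typed (`Cor55Observables`, F-0142) FORCES commuting `ι⊞`-squares at every place**:
for any two 2-chains of `ι⊞`-carrying edges between pre-log vertices of `Γ⃗^log_v` with common end-vertices, the
composites of the `ι⊞`-components agree.  At a nonarchimedean `v` this is the commutativity of the square
`𝒪^×_k̄ ↪ k̄^× → (k̄^×)^pf` / `𝒪^×_k̄ →(shell) k~ ↪ (k̄^×)^pf` of Def 5.4 (iii) transported to the `ι⊞`'s — which print
has (the diagram of Def 5.4 (iii) is commutative and `ι⊞_{v,ε}` is induced by the arrow `ε`, Def 5.4 (vii)) but which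
the interface `LogFrobeniusSetting` does not record among its fields. [cite: MochizukiAbsTopIII2015, Cor 5.5 (iii) p. 131] -/
theorem iota_comp_eq_of_cor55Observables (hobs : L.Cor55Observables) (v : Vmod)
    {ν₁ ν₂ ν₂' ν₃ : LogVertex (isArc v)}
    (h₁ : ν₁.isPostLog = false) (h₂ : ν₂.isPostLog = false) (h₂' : ν₂'.isPostLog = false)
    (h₃ : ν₃.isPostLog = false) (ε₁₂ : LogEdge (isArc v) ν₁ ν₂) (ε₂₃ : LogEdge (isArc v) ν₂ ν₃)
    (ε₁₂' : LogEdge (isArc v) ν₁ ν₂') (ε₂'₃ : LogEdge (isArc v) ν₂' ν₃) (X₀ : L.X)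
    (m₁₂ : (L.lam v ν₁).obj X₀ ⟶ (L.lam v ν₂).obj X₀) (m₂₃ : (L.lam v ν₂).obj X₀ ⟶ (L.lam v ν₃).obj X₀)
    (m₁₂' : (L.lam v ν₁).obj X₀ ⟶ (L.lam v ν₂').obj X₀) (m₂'₃ : (L.lam v ν₂').obj X₀ ⟶ (L.lam v ν₃).obj X₀)
    (hm₁₂ : HEq m₁₂ ((L.iota v ε₁₂).app X₀)) (hm₂₃ : HEq m₂₃ ((L.iota v ε₂₃).app X₀))
    (hm₁₂' : HEq m₁₂' ((L.iota v ε₁₂').app X₀)) (hm₂'₃ : HEq m₂'₃ ((L.iota v ε₂'₃).app X₀)) :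
    m₁₂ ≫ m₂₃ = m₁₂' ≫ m₂'₃ := by
  obtain ⟨H, hH⟩ := hobs v
  exact L.iota_comp_eq_of_isLogObservablePlus v H hH h₁ h₂ h₂' h₃ ε₁₂ ε₂₃ ε₁₂' ε₂'₃ X₀ m₁₂ m₂₃ m₁₂' m₂'₃
    hm₁₂ hm₂₃ hm₁₂' hm₂'₃

/-! ## The nonarchimedean `ι⊞`-square of `Γ⃗^⋉_non` -/

/-- At a NONARCHIMEDEAN place the `ι⊞`-carrying graph `Γ⃗^⋉_non` (Def 5.4 (iii), (vii): every arrow of `Γ⃗^log_non`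
except `k̄^× ↪ k̄`) contains two distinct 2-chains between the pre-log vertices `𝒪^×_k̄` and `(k̄^×)^pf`:
`𝒪^×_k̄ ↪ k̄^× → (k̄^×)^pf` and `𝒪^×_k̄ →(shell) k~ ↪ (k̄^×)^pf` (the commutative square of Def 5.4 (iii)).  Stated for a
Boolean `b = false` so that it applies to `b := isArc v` without transport.
[cite: MochizukiAbsTopIII2015, Def 5.4 (iii) p. 126] -/
theorem exists_iotaSquare_of_eq_false (b : Bool) (hb : b = false) :
    ∃ (ν₁ ν₂ ν₂' ν₃ : LogVertex b) (_ : ν₁.isPostLog = false) (_ : ν₂.isPostLog = false)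
      (_ : ν₂'.isPostLog = false) (_ : ν₃.isPostLog = false), ν₂ ≠ ν₂' ∧
      Nonempty (LogEdge b ν₁ ν₂) ∧ Nonempty (LogEdge b ν₂ ν₃) ∧ Nonempty (LogEdge b ν₁ ν₂') ∧
        Nonempty (LogEdge b ν₂' ν₃) := by
  subst hb
  exact ⟨NonarchVertex.units, NonarchVertex.mult, NonarchVertex.shellCod, NonarchVertex.perf, rfl, rfl, rfl, rfl,
    fun h => NonarchVertex.noConfusion h, ⟨⟨.unitsToMult, trivial⟩⟩, ⟨⟨.multToPerf, trivial⟩⟩,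
    ⟨⟨.shell, trivial⟩⟩, ⟨⟨.shellCodToPerf, trivial⟩⟩⟩

/-- At an ARCHIMEDEAN place there is no such square: `Γ⃗^log_arc` is the linear graph `k~ →(id) k~ ↠ k^× ↪ k`
(Def 5.4 (v)), two 2-chains with the same end-vertices coincide.  Stated for `b = true`.
[cite: MochizukiAbsTopIII2015, Def 5.4 (v) p. 127] -/
theorem logEdge_chain_unique_of_eq_true (b : Bool) (hb : b = true) {ν₁ ν₂ ν₂' ν₃ : LogVertex b}
    (ε₁₂ : LogEdge b ν₁ ν₂) (_ε₂₃ : LogEdge b ν₂ ν₃) (ε₁₂' : LogEdge b ν₁ ν₂') (_ε₂'₃ : LogEdge b ν₂' ν₃) :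
    ν₂ = ν₂' := by
  subst hb
  revert ε₁₂ ε₁₂'
  change ArchEdge ν₁ ν₂ → ArchEdge ν₁ ν₂' → ν₂ = ν₂'
  intro e e'
  cases e <;> cases e' <;> rfl

/-! ## The universal closure of F-0142 is false -/

section Casts

variable {C : Type (u + 1)} [Category.{u} C]

/-- `Λ_ν ∘ 𝟭 = 𝟭` for `log = 𝟭`. [cite: MochizukiAbsTopIII2015, Def 5.4 (vii) p. 128] -/
private theorem frobeniusTwist_id_comp_id' (b : Bool) : frobeniusTwist (𝟭 C) b ⋙ 𝟭 C = 𝟭 C := by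
  cases b <;> rfl

/-- An identity is `HEq` to the component of the `eqToHom` of an equation of endofunctors ending at `𝟭`.
[folklore] -/
private theorem heq_id_eqToHom_app {F : C ⥤ C} (h : F = 𝟭 C) (x : C) :
    HEq (𝟙 x) ((eqToHom h : F ⟶ 𝟭 C).app x) := by
  subst h
  rw [eqToHom_refl, NatTrans.id_app]
  rfl

variable [Preadditive C]

/-- A zero endomorphism is `HEq` to the component of the zero natural transformation between endofunctors equal
to `𝟭`. [folklore] -/
private theorem heq_zero_app_zero {F : C ⥤ C} (h : F = 𝟭 C) (x : C) :
    HEq (0 : x ⟶ x) ((0 : F ⟶ 𝟭 C).app x) := by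
  subst h
  rw [NatTrans.app_zero]
  rfl

end Casts

variable (Vmod isArc)

/-- **The universal closure of `Cor55Observables` (F-0142) is REFUTED at every index set with a nonarchimedean
place**, on any preadditive large category `C` with an object `x₀`, `𝟙 x₀ ≠ 0`: the diagonal setting on `C` (all
rows `C`, all structure functors `𝟭 C`, all equivalences `refl`, all 2-cells identities — as in
`LogFrobeniusSettingNonVacuity.lean`) EXCEPT that `ι⊞_{v,ε} := 0` on the one nonarchimedean edge into `k̄^×`
(`𝒪^×_k̄ ↪ k̄^×`) and the identity identification `Λ_ν ∘ 𝟭 = 𝟭` on every other edge.  Its `ι⊞`-square at a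
nonarchimedean `v₀` reads `0 ≫ 𝟙 ≠ 𝟙 ≫ 𝟙`, so by `iota_comp_eq_of_cor55Observables` no observable `S_log⊞` exists
at `v₀`.  DEGENERATE consistency witness (no arithmetic content): it shows that the typed Cor 5.5 (iii) is an
assumption on `L` beyond the interface, exactly by the commutativity datum of Def 5.4 (iii).
[cite: MochizukiAbsTopIII2015, Cor 5.5 (iii) p. 131] -/
theorem exists_not_cor55Observables_of_preadditive (C : Type (u + 1)) [Category.{u} C] [Preadditive C]
    (x₀ : C) (hx₀ : (𝟙 x₀ : x₀ ⟶ x₀) ≠ 0) (v₀ : Vmod) (hv₀ : isArc v₀ = false) :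
    ∃ L : LogFrobeniusSetting Vmod isArc, L.X = C ∧ ¬ L.Cor55Observables := by
  -- the discriminator of the target vertex `k̄^×` at nonarchimedean places
  let isMult : (b : Bool) → LogVertex b → Bool := fun b =>
    match b with
    | false => fun ν => decide ((show NonarchVertex from ν) = NonarchVertex.mult)
    | true => fun _ => false
  let L₀ : LogFrobeniusSetting Vmod isArc :=
    { X := C
      E := C
      proj := 𝟭 C
      log := 𝟭 C
      logIsoId := Iso.refl _
      logOver := Iso.refl _
      Nplus := fun _ => C
      N := fun _ => C
      forget := fun _ => 𝟭 C
      toE := fun _ => 𝟭 C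
      lam := fun _ _ => 𝟭 C
      lamOver := fun _ _ => Iso.refl _
      lam_spaceLink_eq_postLog := fun _ => rfl
      iota := fun v ν₁ ν₂ _ =>
        if isMult (isArc v) ν₂ then 0 else eqToHom (frobeniusTwist_id_comp_id' (C := C) ν₁.isPostLog)
      An := C
      κAn := CategoryTheory.Equivalence.refl
      φAn := 𝟭 C
      φAn_isEquivalence := inferInstance
      ηAn := Iso.refl _
      κAn₂ := CategoryTheory.Equivalence.refl
      Emono := C
      monoAn := 𝟭 C
      NmonoPlus := fun _ => C
      Nmono := fun _ => C
      forgetMono := fun _ => 𝟭 C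
      toEmono := fun _ => 𝟭 C
      monoNplus := fun _ => 𝟭 C
      monoN := fun _ => 𝟭 C
      monoHomotopy := fun _ => Iso.refl _
      AnMono := C
      κAnMono := CategoryTheory.Equivalence.refl
      ψAnMono := fun _ _ => 𝟭 C }
  refine ⟨L₀, rfl, fun hobs => hx₀ ?_⟩
  -- the nonarchimedean square at `v₀`, with the discriminator values, transported along `isArc v₀ = false`
  have key : ∀ b : Bool, b = false → ∃ (ν₁ ν₂ ν₂' ν₃ : LogVertex b) (_ : ν₁.isPostLog = false)
      (_ : ν₂.isPostLog = false) (_ : ν₂'.isPostLog = false) (_ : ν₃.isPostLog = false),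
      isMult b ν₂ = true ∧ isMult b ν₂' = false ∧ isMult b ν₃ = false ∧
      Nonempty (LogEdge b ν₁ ν₂) ∧ Nonempty (LogEdge b ν₂ ν₃) ∧ Nonempty (LogEdge b ν₁ ν₂') ∧
        Nonempty (LogEdge b ν₂' ν₃) := by
    intro b hb
    subst hb
    exact ⟨NonarchVertex.units, NonarchVertex.mult, NonarchVertex.shellCod, NonarchVertex.perf, rfl, rfl, rfl,
      rfl, rfl, rfl, rfl, ⟨⟨.unitsToMult, trivial⟩⟩, ⟨⟨.multToPerf, trivial⟩⟩, ⟨⟨.shell, trivial⟩⟩,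
      ⟨⟨.shellCodToPerf, trivial⟩⟩⟩
  obtain ⟨ν₁, ν₂, ν₂', ν₃, h₁, h₂, h₂', h₃, i₂, i₂', i₃, ⟨ε₁₂⟩, ⟨ε₂₃⟩, ⟨ε₁₂'⟩, ⟨ε₂'₃⟩⟩ := key (isArc v₀) hv₀
  have hsq := L₀.iota_comp_eq_of_cor55Observables hobs v₀ h₁ h₂ h₂' h₃ ε₁₂ ε₂₃ ε₁₂' ε₂'₃ x₀
    (0 : x₀ ⟶ x₀) (𝟙 x₀) (𝟙 x₀) (𝟙 x₀) ?_ ?_ ?_ ?_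
  · change (0 : x₀ ⟶ x₀) ≫ 𝟙 x₀ = 𝟙 x₀ ≫ 𝟙 x₀ at hsq
    simpa using hsq.symm
  · show HEq (0 : x₀ ⟶ x₀) ((if isMult (isArc v₀) ν₂ then (0 : frobeniusTwist (𝟭 C) ν₁.isPostLog ⋙ 𝟭 C ⟶ 𝟭 C)
      else eqToHom (frobeniusTwist_id_comp_id' (C := C) ν₁.isPostLog)).app x₀)
    rw [if_pos i₂]
    exact heq_zero_app_zero (frobeniusTwist_id_comp_id' (C := C) ν₁.isPostLog) x₀
  · show HEq (𝟙 x₀) ((if isMult (isArc v₀) ν₃ then (0 : frobeniusTwist (𝟭 C) ν₂.isPostLog ⋙ 𝟭 C ⟶ 𝟭 C)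
      else eqToHom (frobeniusTwist_id_comp_id' (C := C) ν₂.isPostLog)).app x₀)
    rw [if_neg (by simp [i₃])]
    exact heq_id_eqToHom_app (frobeniusTwist_id_comp_id' (C := C) ν₂.isPostLog) x₀
  · show HEq (𝟙 x₀) ((if isMult (isArc v₀) ν₂' then (0 : frobeniusTwist (𝟭 C) ν₁.isPostLog ⋙ 𝟭 C ⟶ 𝟭 C)
      else eqToHom (frobeniusTwist_id_comp_id' (C := C) ν₁.isPostLog)).app x₀)
    rw [if_neg (by simp [i₂'])]
    exact heq_id_eqToHom_app (frobeniusTwist_id_comp_id' (C := C) ν₁.isPostLog) x₀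
  · show HEq (𝟙 x₀) ((if isMult (isArc v₀) ν₃ then (0 : frobeniusTwist (𝟭 C) ν₂'.isPostLog ⋙ 𝟭 C ⟶ 𝟭 C)
      else eqToHom (frobeniusTwist_id_comp_id' (C := C) ν₂'.isPostLog)).app x₀)
    rw [if_neg (by simp [i₃])]
    exact heq_id_eqToHom_app (frobeniusTwist_id_comp_id' (C := C) ν₂'.isPostLog) x₀

/-- **F-0142, universal closure REFUTED over every index set with a nonarchimedean place**: the modified diagonal
setting on the category of abelian groups `AddCommGrpCat.{u}` with `x₀ := ℤ` (`𝟙_ℤ ≠ 0`).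
[cite: MochizukiAbsTopIII2015, Cor 5.5 (iii) p. 131] -/
theorem exists_not_cor55Observables (v₀ : Vmod) (hv₀ : isArc v₀ = false) :
    ∃ L : LogFrobeniusSetting Vmod isArc, ¬ L.Cor55Observables := by
  have hx₀ : (𝟙 (AddCommGrpCat.of (ULift.{u} ℤ)) : _ ⟶ _) ≠ 0 := by
    intro h
    have h1 := congrArg (fun f : AddCommGrpCat.of (ULift.{u} ℤ) ⟶ AddCommGrpCat.of (ULift.{u} ℤ) =>
      (f.hom (ULift.up 1)).down) h
    simp at h1
  obtain ⟨L, -, hL⟩ := exists_not_cor55Observables_of_preadditive Vmod isArc AddCommGrpCat.{u} _ hx₀ v₀ hv₀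
  exact ⟨L, hL⟩

/-- **F-0142 as a closed statement is false**: it is NOT the case that every `LogFrobeniusSetting` carries the
observables `S_log⊞` of Cor 5.5 (iii) as typed (index set one nonarchimedean place).  The row is an ASSUMPTION on
the setting — print's Cor 5.5 (iii) for the genuine theaters — whose exact interface-level content is the
commutativity of the `ι⊞`-squares (`iota_comp_eq_of_cor55Observables`; sufficiency in the companion file).
[cite: MochizukiAbsTopIII2015, Cor 5.5 (iii) p. 131] -/
theorem not_forall_cor55Observables :
    ¬ ∀ (Vmod : Type u) (isArc : Vmod → Bool) (L : LogFrobeniusSetting Vmod isArc), L.Cor55Observables := by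
  intro h
  obtain ⟨L, hL⟩ := exists_not_cor55Observables PUnit.{u + 1} (fun _ => false) PUnit.unit rfl
  exact hL (h _ _ L)

end LogFrobeniusSetting

end Literature.AnabelianGeometry.AbsoluteAnabelian
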